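import Mathlib
import Summits.PneNP.PneNP.Theses.OneSlice
import Summits.PneNP.PneNP.Theorems.OneSliceSliceTargetSplit
import Summits.PneNP.PneNP.Theorems.OneSliceSliceTargetSplitStability
import Summits.PneNP.PneNP.Theorems.OneSliceMonotoneContinuationDefs
import Summits.PneNP.PneNP.Theorems.OneSliceMonotoneContinuationSamplerBounds
import Summits.PneNP.PneNP.Theorems.OneSliceMonotoneContinuationPadMixture
import Summits.PneNP.PneNP.Theorems.OneSliceMonotoneContinuationOverlapVariance
import Summits.PneNP.PneNP.Theorems.OneSliceMonotoneContinuationPadFibre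

/-!
# Route OneSlice, crux `MonotoneContinuation` (stmt-PneNP-18471), line `Sketch_ideator1_r1` — bridge `MC → flat-above`,
part 1: the uniform-size padding law and its landing weights

The padding representative of the bridge pads a point `x` of slice `i` by a uniformly random `ρ` with `a` edges,
the size `a` itself uniform on a window `A` (law `padLaw n A`, vocabulary in `…MonotoneContinuationDefs`). This file
regroups `Σ_{x ∈ slice i} Σ_ρ padLaw(ρ) Φ(x, x ∨ ρ)` by the landing level `i + l` of `x ∨ ρ` (`padSum_le`, from
`padMixture_expand`) and proves the three properties of the landing weights `landW n i A l`: total mass one (`landW_sum`),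
the uniform bound `landW ≤ (N+1)/((N+1-i)·#A)` (`landW_le`, from `padFibre_sum`), and the Chebyshev tail bound through the
hypergeometric overlap (`landW_tail_le`, from `overlap_variance`).
-/

set_option linter.dupNamespace false -- `Summit.PneNP.PneNP.…`: summit = sub-problem (D-0017)

namespace Summit.PneNP.PneNP.Theorems.MonotoneContinuation

open Literature.Computability.Complexity hiding supp mem_supp
open Finset hiding slice
open Filter hiding mem_sdiff
open Classical
open Summit.PneNP.PneNP.Theorems (card_slice binomialWeight_tail_le binomialWeight_nonneg)
open Summit.PneNP.PneNP.Theorems.ConstantBand.Negative (Edge thr Central slice)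
open Summit.PneNP.PneNP.Theorems.SingleThreshold.Negative (pc tendsto_pc)
open Summit.PneNP.PneNP.Theorems.SliceACZero.Negative (supp mem_supp card_supp)
open Summit.PneNP.PneNP.Theorems.SliceTargetSplit (nbhd mem_nbhd transport ind l1 card_nbhd_of_le comp_iff_supp
  transport_ind_mem ind_nonneg ind_le_one l1_triangle l1_nonneg transport_nonneg rdist_eq_l1)

noncomputable section

variable {n : ℕ}

/-! ## The padding law (`padLaw`, `padCoef`, `landW` are defined in `…MonotoneContinuationDefs`) -/

/-- A sum over a slice as a sum over the cube with an indicator. -/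
theorem padLanding_sum_slice (a : ℕ) (Φ : (Edge n → Bool) → ℝ) :
    ∑ ρ ∈ slice n a, Φ ρ = ∑ ρ, if edgeCount ρ = a then Φ ρ else 0 := by
  simp only [slice, sum_filter]

/-- Integrating against the padding law: `Σ_ρ padLaw(ρ) Φ(ρ) = Σ_{a ∈ A} (Σ_{ρ ∈ slice a} Φ ρ)/(#A · #slice_a)`. -/
theorem sum_padLaw_mul (A : Finset ℕ) (Φ : (Edge n → Bool) → ℝ) :
    ∑ ρ, padLaw n A ρ * Φ ρ = ∑ a ∈ A, (∑ ρ ∈ slice n a, Φ ρ) / ((#A : ℝ) * #(slice n a)) := by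
  unfold padLaw
  simp_rw [sum_mul]
  rw [sum_comm]
  refine sum_congr rfl fun a _ => ?_
  rw [padLanding_sum_slice, sum_div]
  refine sum_congr rfl fun ρ _ => ?_
  split_ifs <;> ring

/-- The padding law is nonnegative. -/
theorem padLaw_nonneg (A : Finset ℕ) (ρ : Edge n → Bool) : 0 ≤ padLaw n A ρ := by
  unfold padLaw
  refine sum_nonneg fun a _ => ?_
  split_ifs <;> positivity

/-- The padding law is a probability vector (sizes inside the cube, window nonempty). -/
theorem padLaw_sum {A : Finset ℕ} (hA : A.Nonempty) (hAN : ∀ a ∈ A, a ≤ n.choose 2) :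
    ∑ ρ, padLaw n A ρ = 1 := by
  have h := sum_padLaw_mul (n := n) A (fun _ => (1 : ℝ))
  simp_rw [mul_one] at h
  rw [h]
  have hA0 : (#A : ℝ) ≠ 0 := by exact_mod_cast hA.card_pos.ne'
  calc ∑ a ∈ A, (∑ _ρ ∈ slice n a, (1 : ℝ)) / ((#A : ℝ) * #(slice n a))
      = ∑ a ∈ A, (1 : ℝ) / #A := by
        refine sum_congr rfl fun a ha => ?_
        have hs0 : (#(slice n a) : ℝ) ≠ 0 := by exact_mod_cast (card_slice_pos (hAN a ha)).ne'
        rw [sum_const, nsmul_eq_mul, mul_one]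
        field_simp
    _ = 1 := by rw [sum_const, nsmul_eq_mul]; field_simp

/-! ## Regrouping by the landing level -/

/-- **Regrouping.** `Σ_{x ∈ slice i} Σ_ρ padLaw(ρ) Φ(x, x ∨ ρ) = Σ_l (Σ_{a∈A} padCoef/(#A #slice_a)) Σ_{y ∈ slice (i+l)} Σ_{x ∈ nbhd i y} Φ x y`. -/
theorem padSum_expand (i : ℕ) (A : Finset ℕ) (Φ : (Edge n → Bool) → (Edge n → Bool) → ℝ) :
    ∑ x ∈ slice n i, ∑ ρ, padLaw n A ρ * Φ x (fun e => x e || ρ e) =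
      ∑ l ∈ range (n.choose 2 - i + 1), (∑ a ∈ A, padCoef i a l / ((#A : ℝ) * #(slice n a))) *
        ∑ y ∈ slice n (i + l), ∑ x ∈ nbhd i y, Φ x y := by
  have h1 : ∀ x ∈ slice n i, ∑ ρ, padLaw n A ρ * Φ x (fun e => x e || ρ e) =
      ∑ a ∈ A, (∑ ρ ∈ slice n a, Φ x (fun e => x e || ρ e)) / ((#A : ℝ) * #(slice n a)) :=
    fun x _ => sum_padLaw_mul A _
  rw [sum_congr rfl h1, sum_comm]
  have h2 : ∀ a ∈ A, ∑ x ∈ slice n i, (∑ ρ ∈ slice n a, Φ x (fun e => x e || ρ e)) / ((#A : ℝ) * #(slice n a)) =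
      ∑ l ∈ range (n.choose 2 - i + 1), padCoef i a l / ((#A : ℝ) * #(slice n a)) *
        ∑ y ∈ slice n (i + l), ∑ x ∈ nbhd i y, Φ x y := by
    intro a _
    rw [← sum_div, padMixture_expand n i a Φ, sum_div]
    refine sum_congr rfl fun l _ => ?_
    rw [padCoef]; ring
  rw [sum_congr rfl h2, sum_comm]
  refine sum_congr rfl fun l _ => ?_
  rw [sum_mul]

/-- **Regrouping, as an inequality against level bounds.** If on every landing level `i + l` the pair sum of `Φ` is at
most `C(i+l, i) · #slice_{i+l} · ψ l` (i.e. the average over pairs `x ⊆ y` is `≤ ψ l`), then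
`Σ_{x ∈ slice i} Σ_ρ padLaw(ρ) Φ(x, x ∨ ρ) ≤ #slice_i · Σ_l landW(l) ψ(l)`. -/
theorem padSum_le {i : ℕ} (hi : i ≤ n.choose 2) (A : Finset ℕ) (Φ : (Edge n → Bool) → (Edge n → Bool) → ℝ)
    (ψ : ℕ → ℝ)
    (hψ : ∀ l ∈ range (n.choose 2 - i + 1),
      ∑ y ∈ slice n (i + l), ∑ x ∈ nbhd i y, Φ x y ≤ ((i + l).choose i : ℝ) * #(slice n (i + l)) * ψ l) :
    ∑ x ∈ slice n i, ∑ ρ, padLaw n A ρ * Φ x (fun e => x e || ρ e) ≤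
      #(slice n i) * ∑ l ∈ range (n.choose 2 - i + 1), landW n i A l * ψ l := by
  rw [padSum_expand, mul_sum]
  refine sum_le_sum fun l hl => ?_
  have hc : 0 ≤ ∑ a ∈ A, padCoef i a l / ((#A : ℝ) * #(slice n a)) := by
    refine sum_nonneg fun a _ => div_nonneg ?_ (by positivity)
    rw [padCoef]; split_ifs <;> positivity
  have hsi : (0 : ℝ) < #(slice n i) := by exact_mod_cast card_slice_pos hi
  calc (∑ a ∈ A, padCoef i a l / ((#A : ℝ) * #(slice n a))) * ∑ y ∈ slice n (i + l), ∑ x ∈ nbhd i y, Φ x y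
      ≤ (∑ a ∈ A, padCoef i a l / ((#A : ℝ) * #(slice n a))) * (((i + l).choose i : ℝ) * #(slice n (i + l)) * ψ l) :=
        mul_le_mul_of_nonneg_left (hψ l hl) hc
    _ = #(slice n i) * (landW n i A l * ψ l) := by
        rw [landW]; field_simp

/-- The pair count on a landing level: `Σ_{y ∈ slice (i+l)} Σ_{x ∈ nbhd i y} 1 = C(i+l,i) · #slice_{i+l}`. -/
theorem padLanding_pairCount (i l : ℕ) :
    ∑ y ∈ slice n (i + l), ∑ _x ∈ nbhd i y, (1 : ℝ) = ((i + l).choose i : ℝ) * #(slice n (i + l)) := by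
  have h : ∀ y ∈ slice n (i + l), ∑ _x ∈ nbhd i y, (1 : ℝ) = ((i + l).choose i : ℝ) := by
    intro y hy
    have hy' : edgeCount y = i + l := (mem_filter.1 hy).2
    rw [sum_const, nsmul_eq_mul, mul_one, card_nbhd_of_le (by omega), hy']
  rw [sum_congr rfl h, sum_const, nsmul_eq_mul, mul_comm]

/-- The landing weights are nonnegative. -/
theorem landW_nonneg (i : ℕ) (A : Finset ℕ) (l : ℕ) : 0 ≤ landW n i A l := by
  unfold landW
  refine div_nonneg (mul_nonneg (mul_nonneg (sum_nonneg fun a _ => div_nonneg ?_ (by positivity))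
    (Nat.cast_nonneg _)) (Nat.cast_nonneg _)) (Nat.cast_nonneg _)
  rw [padCoef]; split_ifs <;> positivity

/-- **The landing weights have total mass one.** -/
theorem landW_sum {i : ℕ} (hi : i ≤ n.choose 2) {A : Finset ℕ} (hA : A.Nonempty) (hAN : ∀ a ∈ A, a ≤ n.choose 2) :
    ∑ l ∈ range (n.choose 2 - i + 1), landW n i A l = 1 := by
  -- `padSum_expand` with `Φ = 1` computes `#slice_i · Σ_l landW(l)`; the left side is `#slice_i · 1`
  have h := padSum_expand (n := n) i A (fun _ _ => (1 : ℝ))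
  simp_rw [mul_one, padLaw_sum hA hAN] at h
  rw [sum_const, nsmul_eq_mul, mul_one] at h
  have hsi : (0 : ℝ) < #(slice n i) := by exact_mod_cast card_slice_pos hi
  have h2 : ∑ l ∈ range (n.choose 2 - i + 1), landW n i A l =
      (∑ l ∈ range (n.choose 2 - i + 1), (∑ a ∈ A, padCoef i a l / ((#A : ℝ) * #(slice n a))) *
        ∑ y ∈ slice n (i + l), ∑ _x ∈ nbhd i y, (1 : ℝ)) / #(slice n i) := by
    rw [sum_div]
    refine sum_congr rfl fun l _ => ?_
    rw [padLanding_pairCount, landW]; ring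
  rw [h2, ← h, div_self hsi.ne']

/-- **Uniform bound on the landing weights**: `landW(l) ≤ (N+1)/((N+1-i) · #A)` for landing levels inside the cube. -/
theorem landW_le {i : ℕ} (hi : i ≤ n.choose 2) {A : Finset ℕ} (hA : A.Nonempty) (hAN : ∀ a ∈ A, a ≤ n.choose 2)
    {l : ℕ} (hl : i + l ≤ n.choose 2) :
    landW n i A l ≤ (((n.choose 2 : ℝ) + 1) / ((n.choose 2 : ℝ) - i + 1)) / #A := by
  set N := n.choose 2 with hN
  have hsi : (0 : ℝ) < #(slice n i) := by exact_mod_cast card_slice_pos hi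
  have hA0 : (0 : ℝ) < #A := by exact_mod_cast hA.card_pos
  -- the fibre count on one size: `padCoef i a l · C(i+l,i) · #slice_{i+l} = Σ_{x ∈ slice i} #{ρ ∈ slice a : e(x ∨ ρ) = i+l}`
  have hfib : ∀ a : ℕ, padCoef i a l * ((i + l).choose i : ℝ) * #(slice n (i + l)) =
      ∑ x ∈ slice n i, (#((slice n a).filter fun ρ => edgeCount (fun e => x e || ρ e) = i + l) : ℝ) := by
    intro a
    have h := padMixture_expand n i a (fun _ y => if edgeCount y = i + l then (1 : ℝ) else 0)
    have hl' : ∀ x ∈ slice n i, ∑ ρ ∈ slice n a, (if edgeCount (fun e => x e || ρ e) = i + l then (1 : ℝ) else 0) =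
        (#((slice n a).filter fun ρ => edgeCount (fun e => x e || ρ e) = i + l) : ℝ) := by
      intro x _
      rw [← sum_filter, sum_const, nsmul_eq_mul, mul_one]
    rw [sum_congr rfl hl'] at h
    rw [h]
    -- only the term `l' = l` of the right-hand side survives
    have hlr : l ∈ range (N - i + 1) := by rw [mem_range]; omega
    rw [← add_sum_erase _ _ hlr]
    have hrest : ∑ l' ∈ (range (N - i + 1)).erase l, (if l' ≤ a then ((i.choose (a - l') : ℕ) : ℝ) else 0) *
        ∑ y ∈ slice n (i + l'), ∑ _x ∈ nbhd i y, (if edgeCount y = i + l then (1 : ℝ) else 0) = 0 := by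
      refine sum_eq_zero fun l' hl' => ?_
      have hne : l' ≠ l := (mem_erase.1 hl').1
      have : ∑ y ∈ slice n (i + l'), ∑ _x ∈ nbhd i y, (if edgeCount y = i + l then (1 : ℝ) else 0) = 0 := by
        refine sum_eq_zero fun y hy => ?_
        have hy' : edgeCount y = i + l' := (mem_filter.1 hy).2
        have : edgeCount y ≠ i + l := by rw [hy']; omega
        simp [this]
      rw [this, mul_zero]
    have hmain : ∑ y ∈ slice n (i + l), ∑ _x ∈ nbhd i y, (if edgeCount y = i + l then (1 : ℝ) else 0) =
        ((i + l).choose i : ℝ) * #(slice n (i + l)) := by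
      rw [← padLanding_pairCount]
      refine sum_congr rfl fun y hy => sum_congr rfl fun x _ => ?_
      rw [if_pos (mem_filter.1 hy).2]
    rw [hrest, add_zero, hmain, padCoef]; ring
  -- sum over the window with the weights `1/(#A · #slice_a)` and compare with `padFibre_sum`
  have hkey : landW n i A l * #(slice n i) * #A =
      ∑ x ∈ slice n i, ∑ a ∈ A,
        (#((slice n a).filter fun ρ => edgeCount (fun e => x e || ρ e) = i + l) : ℝ) / #(slice n a) := by
    rw [sum_comm]
    have : ∀ a ∈ A, ∑ x ∈ slice n i,
        (#((slice n a).filter fun ρ => edgeCount (fun e => x e || ρ e) = i + l) : ℝ) / #(slice n a) =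
        padCoef i a l * ((i + l).choose i : ℝ) * #(slice n (i + l)) / #(slice n a) := by
      intro a _
      rw [← sum_div, hfib a]
    rw [sum_congr rfl this, landW, div_mul_cancel₀ _ hsi.ne', sum_mul, sum_mul, sum_mul]
    refine sum_congr rfl fun a ha => ?_
    have hs0 : (#(slice n a) : ℝ) ≠ 0 := by exact_mod_cast (card_slice_pos (hAN a ha)).ne'
    field_simp
  have hbound : ∀ x ∈ slice n i, ∑ a ∈ A,
      (#((slice n a).filter fun ρ => edgeCount (fun e => x e || ρ e) = i + l) : ℝ) / #(slice n a) ≤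
      ((N : ℝ) + 1) / ((N : ℝ) - i + 1) := by
    intro x hx
    have hxi : edgeCount x = i := (mem_filter.1 hx).2
    rw [← padFibre_sum n i (i + l) x hxi (by omega) hl]
    refine sum_le_sum_of_subset_of_nonneg (fun a ha => ?_) (fun a _ _ => by positivity)
    rw [mem_range]; exact Nat.lt_succ_of_le (hAN a ha)
  have htot : landW n i A l * #(slice n i) * #A ≤ #(slice n i) * (((N : ℝ) + 1) / ((N : ℝ) - i + 1)) := by
    rw [hkey, ← nsmul_eq_mul, ← sum_const]
    · exact sum_le_sum hbound
  rw [le_div_iff₀ hA0]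
  nlinarith [htot, hsi]

/-- The edge count of a join through supports: `e(x ∨ ρ) + #(supp ρ ∩ supp x) = e(x) + e(ρ)`. -/
theorem padLanding_edgeCount_join (x ρ : Edge n → Bool) :
    edgeCount (fun e => x e || ρ e) + #(supp ρ ∩ supp x) = edgeCount x + edgeCount ρ := by
  have hsupp : supp (fun e => x e || ρ e) = supp x ∪ supp ρ := by
    ext e; simp [mem_supp, Bool.or_eq_true]
  rw [← card_supp, ← card_supp x, ← card_supp ρ, hsupp, inter_comm]
  exact card_union_add_card_inter _ _

/-- **Chebyshev tail of the landing weights.** If every offset `l` of the set `Bad` forces the hypergeometric overlap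
`H = e(x) + e(ρ) − e(x ∨ ρ)` to deviate from its mean `a·i/N` by at least `u > 0` for every size `a ∈ A`, then the
landing weights of those offsets sum to at most `B` whenever `a·i/(N u²) ≤ B` on the window. -/
theorem landW_tail_le {i : ℕ} (hi : i ≤ n.choose 2) {A : Finset ℕ} (hA : A.Nonempty) (hAN : ∀ a ∈ A, a ≤ n.choose 2)
    {Bad : Finset ℕ} (hBad : Bad ⊆ range (n.choose 2 - i + 1)) {u B : ℝ} (hu : 0 < u)
    (hP : ∀ a ∈ A, ∀ l ∈ Bad, ∀ h : ℕ, (l : ℝ) = a - h → u ≤ |(h : ℝ) - (a : ℝ) * i / (n.choose 2)|)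
    (hB : ∀ a ∈ A, (a : ℝ) * i / (n.choose 2) / u ^ 2 ≤ B) :
    ∑ l ∈ Bad, landW n i A l ≤ B := by
  set N := n.choose 2 with hN
  have hsi : (0 : ℝ) < #(slice n i) := by exact_mod_cast card_slice_pos hi
  have hA0 : (0 : ℝ) < #A := by exact_mod_cast hA.card_pos
  -- the indicator of the bad landing levels, regrouped
  set Φ : (Edge n → Bool) → (Edge n → Bool) → ℝ := fun _ y => if edgeCount y - i ∈ Bad then 1 else 0 with hΦ
  -- the left side, size by size, is a Chebyshev count
  have h2 : ∀ x ∈ slice n i, ∑ ρ, padLaw n A ρ * Φ x (fun e => x e || ρ e) ≤ ∑ a ∈ A, ((a : ℝ) * i / N / u ^ 2) / #A := by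
    intro x hx
    have hxi : edgeCount x = i := (mem_filter.1 hx).2
    rw [sum_padLaw_mul]
    refine sum_le_sum fun a ha => ?_
    have hsa : (0 : ℝ) < #(slice n a) := by exact_mod_cast card_slice_pos (hAN a ha)
    -- `Σ_{ρ ∈ slice a} Φ ≤ #{ρ : u ≤ |H - ai/N|} ≤ (1/u²) Σ (H - ai/N)² ≤ #slice_a (ai/N)/u²`
    have hcheb : ∑ ρ ∈ slice n a, Φ x (fun e => x e || ρ e) ≤ #(slice n a) * ((a : ℝ) * i / N) / u ^ 2 := by
      have hpt : ∀ ρ ∈ slice n a, Φ x (fun e => x e || ρ e) ≤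
          ((#(supp ρ ∩ supp x) : ℝ) - (a : ℝ) * i / N) ^ 2 / u ^ 2 := by
        intro ρ hρ
        have hρa : edgeCount ρ = a := (mem_filter.1 hρ).2
        simp only [hΦ]
        split_ifs with hPl
        · have hjoin := padLanding_edgeCount_join x ρ
          rw [hxi, hρa] at hjoin
          have h1 : i ≤ edgeCount (fun e => x e || ρ e) := by
            have : #(supp ρ ∩ supp x) ≤ #(supp ρ) := card_le_card inter_subset_left
            rw [card_supp, hρa] at this; omega
          have hcast : ((edgeCount (fun e => x e || ρ e) - i : ℕ) : ℝ) = a - (#(supp ρ ∩ supp x) : ℝ) := by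
            rw [Nat.cast_sub h1]
            have := congrArg (Nat.cast (R := ℝ)) hjoin
            push_cast at this
            linarith
          have hdev := hP a ha _ hPl (#(supp ρ ∩ supp x)) hcast
          rw [le_div_iff₀ (pow_pos hu 2), one_mul]
          have hu2 : u ^ 2 ≤ |(#(supp ρ ∩ supp x) : ℝ) - (a : ℝ) * i / N| ^ 2 := pow_le_pow_left₀ hu.le hdev 2
          rwa [sq_abs] at hu2
        · positivity
      calc ∑ ρ ∈ slice n a, Φ x (fun e => x e || ρ e)
          ≤ ∑ ρ ∈ slice n a, ((#(supp ρ ∩ supp x) : ℝ) - (a : ℝ) * i / N) ^ 2 / u ^ 2 := sum_le_sum hpt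
        _ = (∑ ρ ∈ slice n a, ((#(supp ρ ∩ supp x) : ℝ) - (a : ℝ) * i / N) ^ 2) / u ^ 2 := by rw [sum_div]
        _ ≤ #(slice n a) * ((a : ℝ) * i / N) / u ^ 2 :=
            div_le_div_of_nonneg_right (overlap_variance n i a x hxi (hAN a ha)) (sq_nonneg u)
    rw [div_le_div_iff₀ (by positivity) hA0]
    calc (∑ ρ ∈ slice n a, Φ x (fun e => x e || ρ e)) * #A ≤ (#(slice n a) * ((a : ℝ) * i / N) / u ^ 2) * #A :=
          mul_le_mul_of_nonneg_right hcheb hA0.le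
      _ = (a : ℝ) * i / N / u ^ 2 * (#A * #(slice n a)) := by ring
  have h3 : ∑ x ∈ slice n i, ∑ ρ, padLaw n A ρ * Φ x (fun e => x e || ρ e) ≤ #(slice n i) * B := by
    calc ∑ x ∈ slice n i, ∑ ρ, padLaw n A ρ * Φ x (fun e => x e || ρ e)
        ≤ ∑ _x ∈ slice n i, ∑ a ∈ A, ((a : ℝ) * i / N / u ^ 2) / #A := sum_le_sum h2
      _ ≤ ∑ _x ∈ slice n i, B := by
          refine sum_le_sum fun x _ => ?_
          calc ∑ a ∈ A, ((a : ℝ) * i / N / u ^ 2) / #A ≤ ∑ _a ∈ A, B / #A :=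
                sum_le_sum fun a ha => div_le_div_of_nonneg_right (hB a ha) hA0.le
            _ = B := by rw [sum_const, nsmul_eq_mul]; field_simp
      _ = #(slice n i) * B := by rw [sum_const, nsmul_eq_mul]
  -- the left side computed exactly through the landing weights
  have hexact : ∑ x ∈ slice n i, ∑ ρ, padLaw n A ρ * Φ x (fun e => x e || ρ e) =
      #(slice n i) * ∑ l ∈ range (N - i + 1), landW n i A l * (if l ∈ Bad then 1 else 0) := by
    rw [padSum_expand, mul_sum]
    refine sum_congr rfl fun l _ => ?_
    have hlev : ∑ y ∈ slice n (i + l), ∑ x ∈ nbhd i y, Φ x y =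
        ((i + l).choose i : ℝ) * #(slice n (i + l)) * (if l ∈ Bad then 1 else 0) := by
      rw [← padLanding_pairCount, sum_mul]
      refine sum_congr rfl fun y hy => ?_
      rw [sum_mul]
      refine sum_congr rfl fun x _ => ?_
      have hy' : edgeCount y = i + l := (mem_filter.1 hy).2
      simp only [hΦ, hy', Nat.add_sub_cancel_left, one_mul]
    rw [hlev, landW]
    field_simp
  rw [hexact] at h3
  have h4 : ∑ l ∈ range (N - i + 1), landW n i A l * (if l ∈ Bad then 1 else 0) ≤ B := le_of_mul_le_mul_left h3 hsi
  have hBad' : Bad = (range (N - i + 1)).filter (fun l => l ∈ Bad) := by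
    rw [filter_mem_eq_inter, inter_eq_right.2 hBad]
  rw [hBad', sum_filter]
  calc ∑ l ∈ range (N - i + 1), (if l ∈ Bad then landW n i A l else 0)
      = ∑ l ∈ range (N - i + 1), landW n i A l * (if l ∈ Bad then 1 else 0) :=
        sum_congr rfl fun l _ => by split_ifs <;> simp
    _ ≤ B := h4


/-! ## Registered form -/

/-- **Landing weights of the uniform-size padding** (registered sub-goal `padLanding` of stmt-PneNP-18471): total mass one
and the uniform bound `(N+1)/((N+1-i) #A)`. [folklore] -/
theorem padLanding :
  ∀ (n i : ℕ) (A : Finset ℕ), i ≤ n.choose 2 → A.Nonempty → (∀ a ∈ A, a ≤ n.choose 2) →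
    (∑ l ∈ range (n.choose 2 - i + 1), landW n i A l) = 1 ∧
    ∀ l : ℕ, i + l ≤ n.choose 2 → landW n i A l ≤ (((n.choose 2 : ℝ) + 1) / ((n.choose 2 : ℝ) - i + 1)) / #A :=
  fun _ _ _ hi hA hAN => ⟨landW_sum hi hA hAN, fun _ hl => landW_le hi hA hAN hl⟩

end

end Summit.PneNP.PneNP.Theorems.MonotoneContinuation
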